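import Summits.BirchSwinnertonDyer.BirchSwinnertonDyer.Theorems.UniversalToricDescentSigmaLocalProductAnyTorsion
import HarnessLib

/-!
# Route UniversalToricDescent — the `Σ`-Euler-factor product and the divisibility of `Sel_𝔭^S` for a curve WITHOUT
# base data, from two tower-level sockets: the `Σ`-local surjectivity (Greenberg–Vatsal Cor. 2.3) and
# «no non-zero finite `Λ`-submodule» as HYPOTHESES

Lead prover bsd-wall-utd-p1 g14 (`--supports` ♭T′ stmt-BirchSwinnertonDyer-26975; stub B′ `stub_lambdaTransportPT`, RANK-FREE road for
the TWIN `E′`, memo RESIDUE-B-PRIME-utdp1g13 §10). g13's `natCard_quotient_pTorsion_eq_prod_of_finite_anyTorsion` (GV (2.10)) and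
`selmerAc_divisible_of_finite_pTorsion_anyTorsion` take base finiteness `Sel_𝔮(K, E[p^∞]) < ∞` — false for a twin of `K`-rank
`≥ 2`. They use it only through (L10)^S (no finite submodule of `X^S`) and Cor. 2.3 (loc_v onto over `K_∞`). This file
re-derives the same conclusions from those two TOWER statements as hypotheses:

* §1 `exists_mem_forall_fin_of_forall_sig` — tuples from equivariant signatures (the extension `d γ^i h ↦ conj_d f_i`,
  generic in the source subgroup and the place; proof VERBATIM the tree's);
* §2 `selmerAc_divisible_of_finite_pTorsion_of_noFinite` — `Sel^S = p·Sel^S` from `Sel^S[p]` finite + (N1)^S;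
* §3 `natCard_quotient_pTorsion_eq_pow_of_surj` — `#(Sel^{S∪{v}}/Sel^S)[p] = (#H¹(H ∩ D_v, E[p^∞])[p])^{p^c}` from the
  tuple surjectivity at `v` as a hypothesis; §4 `natCard_quotient_pTorsion_eq_prod_of_surj` — the product over `T` by
  induction, divisibility of the intermediate groups as a hypothesis.

HONEST STATUS: helper theorems (sockets of the rank-free road; the twin's tower inputs stay hypotheses here). THEOREMS ONLY; no
definition, no named fact, no `sorry`. BSD is not advanced by this file.
References: [GreenbergVatsal2000] §2 Cor. (2.3), Prop. (2.4), (2.8), (2.10) (pp. 24–28); [GreenbergLNM1716] §4 pp. 122–126.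
-/

set_option autoImplicit false
-- `…BirchSwinnertonDyer.BirchSwinnertonDyer.Theorems…` is the problem's mandated namespace (D-0017).
set_option linter.dupNamespace false

noncomputable section
open scoped Classical

namespace Summit.BirchSwinnertonDyer.BirchSwinnertonDyer.Theorems.UniversalToricDescentSigmaLocalImage

open CategoryTheory Function Field NumberField IsDedekindDomain WeierstrassCurve
open Literature.NumberTheory.GaloisRepresentations Literature.NumberTheory.EllipticCurves
  Literature.NumberTheory.EllipticCurves.GreenbergSelmer Literature.NumberTheory.GaloisCohomology
  Literature.NumberTheory.EllipticCurves.Rank1Residual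
  Summit.BirchSwinnertonDyer.Rank1Residual Summit.BirchSwinnertonDyer.Rank1Residual.X11b
  Summit.BirchSwinnertonDyer.Rank1Residual.X11b.Coinv Summit.BirchSwinnertonDyer.Rank1Residual.X11b.LocBridge
  Summit.BirchSwinnertonDyer.Rank1Residual.X11b.AcSelmer
  Summit.BirchSwinnertonDyer.BirchSwinnertonDyer.Theorems.UniversalToricDescentSigmaCoinvariants
  Summit.BirchSwinnertonDyer.BirchSwinnertonDyer.Theorems.UniversalToricDescentSigmaLocalStabilizer
open Literature.NumberTheory.EllipticCurves.IwasawaAlgebra Summit.BirchSwinnertonDyer.Rank1Residual.Iwasawa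
  Summit.BirchSwinnertonDyer.BirchSwinnertonDyer.Theorems.UniversalToricDescentSigmaFree
  Summit.BirchSwinnertonDyer.BirchSwinnertonDyer.Theorems.UniversalToricDescentAcDualMuZero
  Summit.BirchSwinnertonDyer.BirchSwinnertonDyer.Theorems.UniversalToricDescentNoFiniteSubmodule

variable {K : Type} [Field K] [NumberField K] (W : WeierstrassCurve K) (p : ℕ) [Fact p.Prime] (κ : ZpExtension K p)

/-! ### §1 Tuples from equivariant signatures -/

/-- **Every tuple `(f_i)_{i<p^c}` of classes of `H¹(H ∩ D_v, E[p^∞])` is `(res_{H∩D_v}(conj_{γ^i} s))_i` for some `s`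
in a given subgroup `G ≤ H¹(K_∞, E[p^∞])`, as soon as every right-`H`-invariant left-`D_v`-equivariant signature is** (`hsig`):
the tuple extends to the equivariant function `d γ^i h ↦ conj_d f_i` (well defined by the uniqueness of `σ = d γ^i h`,
`i < p^c`, modulo `H ∩ D_v`, for the exact index `κ(D_v) = p^c ℤ_p`). Proof VERBATIM the extension step of
`exists_mem_relaxed_forall_fin_resKerD_eq` (g13), generic in `G` and `v`. [cite: GreenbergVatsal2000, §2 Cor. (2.3) (pp. 24–25)] -/
theorem exists_mem_forall_fin_of_forall_sig {γ : absoluteGaloisGroup K} (hγ : κ.IsTopGenerator γ)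
    (v : HeightOneSpectrum (𝓞 K)) {c : ℕ}
    (hc : ∀ z : ℤ_[p], ∃ d : decomp (K := K) v, (κ (d : absoluteGaloisGroup K)).toAdd = (p : ℤ_[p]) ^ c * z)
    (hle : ∀ d : decomp (K := K) v, (p : ℤ_[p]) ^ c ∣ (κ (d : absoluteGaloisGroup K)).toAdd)
    (G : AddSubgroup (W.subgroupH1 p κ.kerSubgroup))
    (hsig : ∀ (F : absoluteGaloisGroup K → subgroupH1 (kerD κ v) (W.geomPrimaryTorsion p)),
      (∀ (σ h : absoluteGaloisGroup K), h ∈ κ.kerSubgroup → F (σ * h) = F σ) →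
      (∀ (d : decomp (K := K) v) (σ : absoluteGaloisGroup K),
        F ((d : absoluteGaloisGroup K) * σ) = conjH1 (kerD κ v) (W.geomPrimaryTorsion p) d (F σ)) →
      ∃ s ∈ G, ∀ σ : absoluteGaloisGroup K,
        resKerD κ (W.geomPrimaryTorsion p) v (W.conjH1 p κ.kerSubgroup σ s) = F σ)
    (f : Fin (p ^ c) → subgroupH1 (kerD κ v) (W.geomPrimaryTorsion p)) :
    ∃ s ∈ G, ∀ i : Fin (p ^ c),
      resKerD κ (W.geomPrimaryTorsion p) v (W.conjH1 p κ.kerSubgroup (γ ^ (i : ℕ)) s) = f i := by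
  set H := κ.kerSubgroup with hH
  -- the decomposition `σ = d(σ) γ^{n(σ)} h(σ)`
  choose dσ nσ hσ hnσ hhσ heσ using exists_decomp_mul_pow_lt_mul_mem_ker κ hγ v hc
  -- `conj_d` only depends on `d` modulo `H ∩ D_v`
  have hconj : ∀ (d d' : decomp (K := K) v) (x : subgroupH1 (kerD κ v) (W.geomPrimaryTorsion p)),
      ((d⁻¹ * d' : decomp (K := K) v) : absoluteGaloisGroup K) ∈ H →
      conjH1 (kerD κ v) (W.geomPrimaryTorsion p) d' x =
        conjH1 (kerD κ v) (W.geomPrimaryTorsion p) d x := by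
    intro d d' x hmem
    conv_lhs => rw [← mul_inv_cancel_left d d', conjH1_mul_holds (kerD κ v),
      AddMonoidHom.comp_apply, conjH1_of_mem_holds (kerD κ v) _ ((mem_kerD_iff κ v _).2 hmem),
      AddMonoidHom.id_apply]
  -- uniqueness of the decomposition
  have huniq : ∀ (d d' : decomp (K := K) v) (i j : ℕ) (h h' : absoluteGaloisGroup K),
      i < p ^ c → j < p ^ c → h ∈ H → h' ∈ H →
      (d : absoluteGaloisGroup K) * γ ^ i * h = (d' : absoluteGaloisGroup K) * γ ^ j * h' →
      i = j ∧ ((d'⁻¹ * d : decomp (K := K) v) : absoluteGaloisGroup K) ∈ H := by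
    intro d d' i j h h' hi hj hh hh' e
    have hij := eq_of_decomp_mul_pow_mul_eq κ hγ v hle hi hj hh hh' e
    subst hij
    refine ⟨rfl, ?_⟩
    have e' : ((d'⁻¹ * d : decomp (K := K) v) : absoluteGaloisGroup K) =
        γ ^ i * (h' * h⁻¹) * (γ ^ i)⁻¹ := by
      have e2 : (d : absoluteGaloisGroup K) =
          (d' : absoluteGaloisGroup K) * γ ^ i * h' * h⁻¹ * (γ ^ i)⁻¹ := by
        rw [← e]; group
      rw [Subgroup.coe_mul, Subgroup.coe_inv, e2]
      group
    rw [e']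
    exact Subgroup.Normal.conj_mem inferInstance _ (H.mul_mem hh' (H.inv_mem hh)) _
  let F : absoluteGaloisGroup K → subgroupH1 (kerD κ v) (W.geomPrimaryTorsion p) :=
    fun σ ↦ conjH1 (kerD κ v) (W.geomPrimaryTorsion p) (dσ σ) (f ⟨nσ σ, hnσ σ⟩)
  have hFapply : ∀ σ, F σ = conjH1 (kerD κ v) (W.geomPrimaryTorsion p) (dσ σ) (f ⟨nσ σ, hnσ σ⟩) :=
    fun _ ↦ rfl
  -- `F(d γ^i h) = conj_d (f i)`
  have hFval : ∀ (d : decomp (K := K) v) (i : ℕ) (hi : i < p ^ c) (h : absoluteGaloisGroup K),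
      h ∈ H → F ((d : absoluteGaloisGroup K) * γ ^ i * h) =
        conjH1 (kerD κ v) (W.geomPrimaryTorsion p) d (f ⟨i, hi⟩) := by
    intro d i hi h hh
    set σ := (d : absoluteGaloisGroup K) * γ ^ i * h with hσdef
    obtain ⟨hij, hmem⟩ := huniq d (dσ σ) i (nσ σ) h (hσ σ) hi (hnσ σ) hh (hhσ σ) (heσ σ)
    rw [hFapply, hconj d (dσ σ) _ ?_]
    · congr 2
      exact Fin.ext hij.symm
    · -- `d⁻¹ dσ ∈ H` from `(dσ)⁻¹ d ∈ H`
      have := H.inv_mem hmem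
      rwa [← Subgroup.coe_inv, mul_inv_rev, inv_inv] at this
  have hFH : ∀ (σ h : absoluteGaloisGroup K), h ∈ H → F (σ * h) = F σ := by
    intro σ h hh
    conv_lhs => rw [heσ σ, mul_assoc, hFval (dσ σ) (nσ σ) (hnσ σ) _ (H.mul_mem (hhσ σ) hh)]
  have hFD : ∀ (d : decomp (K := K) v) (σ : absoluteGaloisGroup K),
      F ((d : absoluteGaloisGroup K) * σ) =
        conjH1 (kerD κ v) (W.geomPrimaryTorsion p) d (F σ) := by
    intro d σ
    conv_lhs => rw [heσ σ, ← mul_assoc, ← mul_assoc, ← Subgroup.coe_mul,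
      hFval (d * dσ σ) (nσ σ) (hnσ σ) _ (hhσ σ)]
    rw [conjH1_mul_holds (kerD κ v), AddMonoidHom.comp_apply, hFapply]
  obtain ⟨s, hs, hsF⟩ := hsig F hFH hFD
  refine ⟨s, hs, fun i ↦ ?_⟩
  obtain ⟨i, hi⟩ := i
  change resKerD κ (W.geomPrimaryTorsion p) v (W.conjH1 p H (γ ^ i) s) = f ⟨i, hi⟩
  rw [hsF, show γ ^ i = ((1 : decomp (K := K) v) : absoluteGaloisGroup K) * γ ^ i * 1 by
    rw [Subgroup.coe_one, one_mul, mul_one], hFval 1 i hi 1 H.one_mem,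
    Literature.NumberTheory.EllipticCurves.conjH1_one_holds (kerD κ v), AddMonoidHom.id_apply]

/-! ### §2 Divisibility of `Sel_𝔭^S` from finite `p`-torsion + (N1)^S -/

/-- **`Sel_𝔭^S(K_∞, E[p^∞]) = p · Sel_𝔭^S`** for a finite `S` with `Sel^S[p]` finite and `X^S` without non-zero finite
`Λ`-submodule (hypothesis `hnf`, (N1)^S): `X^S` is torsion with `μ = 0` (criterion (A)), hence `ℤ_p`-torsion-free, so `Sel^S`
is `p`-divisible. g13's `selmerAc_divisible_of_finite_pTorsion_anyTorsion` with its (L10)-input replaced by `hnf`.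
[cite: GreenbergVatsal2000, §2 Prop. (2.8)] [cite: GreenbergLNM1716, Prop. 4.14–4.15 (pp. 124–126)] -/
theorem selmerAc_divisible_of_finite_pTorsion_of_noFinite [W.IsElliptic] (𝔭 : HeightOneSpectrum (𝓞 K))
    (γ : absoluteGaloisGroup K) [Fact (κ.IsTopGenerator γ)] {S : Set (HeightOneSpectrum (𝓞 K))}
    (hS : S.Finite) (hfinS : Set.Finite {s : selmerAc W p κ 𝔭 S | p • s = 0})
    (hnf : ∀ N : Submodule (IwasawaAlgebra p) (XAc W p κ 𝔭 S γ), Finite N → N = ⊥) :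
    ∀ s ∈ selmerAc W p κ 𝔭 S, ∃ s' ∈ selmerAc W p κ 𝔭 S, p • s' = s := by
  intro s hs
  have hT := isTorsion_of_finite_pTorsion W p κ 𝔭 S γ hS hfinS
  have hμ := muInvariant_eq_zero_of_finite_pTorsion W p κ 𝔭 S γ hS hfinS
  have h0 := XAc.eq_zero_of_nsmul_eq_zero W p κ 𝔭 S γ hS hT hμ hnf
  obtain ⟨t, ht⟩ := selmerAc_divisible_of_forall W p κ 𝔭 S γ h0 ⟨s, hs⟩
  exact ⟨t, t.2, by rw [← AddSubgroupClass.coe_nsmul, ht]⟩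

/-! ### §3 The one-place count from the tuple surjectivity at `v` -/

/-- **`Sel_𝔭^{Σ∪{v}}/Sel_𝔭^Σ ≅ H¹(H ∩ D_v, E[p^∞])^{p^c}` and `#(Sel^{Σ∪{v}}/Sel^Σ)[p] = (#H¹(H ∩ D_v, E[p^∞])[p])^{p^c}`**
for `v ∤ p`, `v ∉ Σ` with exact index `κ(D_v) = p^c ℤ_p`, GIVEN the tuple surjectivity `hsurj` at `v` out of `Sel^{Σ∪{v}}`
(for a curve with base finiteness: `exists_mem_selmerAc_insert_forall_resKerD_conjH1_eq_anyTorsion` + §1; for the twin: the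
tower-level socket). Proof VERBATIM g13's `natCard_quotient_pTorsion_eq_pow_anyTorsion`, the surjectivity re-sourced.
[cite: GreenbergVatsal2000, §2 Cor. (2.3), Prop. (2.4) and (2.10) (pp. 24–28)] [cite: Castella2018, Def. 2.2 (arXiv:1704.06608 p. 5)] -/
theorem natCard_quotient_pTorsion_eq_pow_of_surj
    {𝔭 : HeightOneSpectrum (𝓞 K)} {γ : absoluteGaloisGroup K} (hγ : κ.IsTopGenerator γ) {S : Set (HeightOneSpectrum (𝓞 K))}
    {v : HeightOneSpectrum (𝓞 K)} (hpv : ((p : ℕ) : 𝓞 K) ∉ v.asIdeal) (hvS : v ∉ S) {c : ℕ}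
    (hc : ∀ z : ℤ_[p], ∃ d : decomp (K := K) v,
      (κ (d : absoluteGaloisGroup K)).toAdd = (p : ℤ_[p]) ^ c * z)
    (hsurj : ∀ f : Fin (p ^ c) → subgroupH1 (kerD κ v) (W.geomPrimaryTorsion p),
      ∃ s ∈ selmerAc W p κ 𝔭 (insert v S), ∀ i : Fin (p ^ c),
        resKerD κ (W.geomPrimaryTorsion p) v (W.conjH1 p κ.kerSubgroup (γ ^ (i : ℕ)) s) = f i) :
    Nonempty ((selmerAc W p κ 𝔭 (insert v S) ⧸
        (selmerAc W p κ 𝔭 S).addSubgroupOf (selmerAc W p κ 𝔭 (insert v S))) ≃+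
        (Fin (p ^ c) → subgroupH1 (kerD κ v) (W.geomPrimaryTorsion p))) ∧
      Nat.card {b : selmerAc W p κ 𝔭 (insert v S) ⧸
          (selmerAc W p κ 𝔭 S).addSubgroupOf (selmerAc W p κ 𝔭 (insert v S)) // p • b = 0} =
        Nat.card {f : subgroupH1 (kerD κ v) (W.geomPrimaryTorsion p) // p • f = 0} ^ (p ^ c) := by
  set H := κ.kerSubgroup with hH
  -- the evaluation map
  let Ψ : selmerAc W p κ 𝔭 (insert v S) →+ (Fin (p ^ c) → subgroupH1 (kerD κ v) (W.geomPrimaryTorsion p)) :=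
    { toFun := fun s i ↦ resKerD κ (W.geomPrimaryTorsion p) v (W.conjH1 p H (γ ^ (i : ℕ)) s)
      map_zero' := funext fun i ↦ by simp
      map_add' := fun a b ↦ funext fun i ↦ by simp }
  have hΨapply : ∀ (s : selmerAc W p κ 𝔭 (insert v S)) (i : Fin (p ^ c)),
      Ψ s i = resKerD κ (W.geomPrimaryTorsion p) v (W.conjH1 p H (γ ^ (i : ℕ)) s) := fun _ _ ↦ rfl
  -- signatures are right-`H`-invariant and left-`D_v`-equivariant
  have hsig : ∀ (x : W.subgroupH1 p H) (d : decomp (K := K) v) (σ h : absoluteGaloisGroup K), h ∈ H →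
      resKerD κ (W.geomPrimaryTorsion p) v (W.conjH1 p H ((d : absoluteGaloisGroup K) * σ * h) x) =
        conjH1 (kerD κ v) (W.geomPrimaryTorsion p) d
          (resKerD κ (W.geomPrimaryTorsion p) v (W.conjH1 p H σ x)) := by
    intro x d σ h hh
    rw [W.conjH1_mul_holds p H, AddMonoidHom.comp_apply, W.conjH1_of_mem_holds p H hh,
      AddMonoidHom.id_apply, W.conjH1_mul_holds p H, AddMonoidHom.comp_apply, resKerD_conjH1]
  -- (i) the kernel of `Ψ` is `Sel^Σ`
  have hker : Ψ.ker = (selmerAc W p κ 𝔭 S).addSubgroupOf (selmerAc W p κ 𝔭 (insert v S)) := by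
    ext s
    rw [AddMonoidHom.mem_ker, AddSubgroup.mem_addSubgroupOf,
      ← forall_resKerD_conjH1_eq_zero_iff_mem_selmerAc W p κ hpv hvS s.2]
    constructor
    · intro h0 σ
      obtain ⟨d, n, h, hn, hh, rfl⟩ := exists_decomp_mul_pow_lt_mul_mem_ker κ hγ v hc σ
      rw [hsig _ d _ h hh, ← hΨapply s ⟨n, hn⟩, h0, Pi.zero_apply, map_zero]
    · intro h0
      funext i
      rw [hΨapply, h0, Pi.zero_apply]
  -- (ii) `Ψ` is onto
  have hsurjΨ : Function.Surjective Ψ := by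
    intro f
    obtain ⟨s, hs, hsf⟩ := hsurj f
    exact ⟨⟨s, hs⟩, funext fun i ↦ by rw [hΨapply]; exact hsf i⟩
  -- (iii) the isomorphism and the count
  let e : (selmerAc W p κ 𝔭 (insert v S) ⧸
      (selmerAc W p κ 𝔭 S).addSubgroupOf (selmerAc W p κ 𝔭 (insert v S))) ≃+
      (Fin (p ^ c) → subgroupH1 (kerD κ v) (W.geomPrimaryTorsion p)) :=
    (QuotientAddGroup.quotientAddEquivOfEq hker.symm).trans
      (QuotientAddGroup.quotientKerEquivOfSurjective Ψ hsurjΨ)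
  refine ⟨⟨e⟩, ?_⟩
  have h1 : Nat.card {b : selmerAc W p κ 𝔭 (insert v S) ⧸
      (selmerAc W p κ 𝔭 S).addSubgroupOf (selmerAc W p κ 𝔭 (insert v S)) // p • b = 0} =
      Nat.card {g : Fin (p ^ c) → subgroupH1 (kerD κ v) (W.geomPrimaryTorsion p) // p • g = 0} := by
    refine Nat.card_congr (Equiv.subtypeEquiv e.toEquiv fun b ↦ ?_)
    show p • b = 0 ↔ p • e b = 0
    rw [← map_nsmul, ← e.map_zero]
    exact e.injective.eq_iff.symm
  have h2' : Nat.card {g : Fin (p ^ c) → subgroupH1 (kerD κ v) (W.geomPrimaryTorsion p) // p • g = 0} =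
      Nat.card (Fin (p ^ c) → {f : subgroupH1 (kerD κ v) (W.geomPrimaryTorsion p) // p • f = 0}) := by
    refine Nat.card_congr
      { toFun := fun g i ↦ ⟨g.1 i, congrFun g.2 i⟩
        invFun := fun g ↦ ⟨fun i ↦ (g i).1, funext fun i ↦ (g i).2⟩
        left_inv := fun g ↦ rfl
        right_inv := fun g ↦ rfl }
  rw [h1, h2', Nat.card_fun, Nat.card_fin]

/-! ### §4 The product over a finite set of finitely decomposed places -/

/-- **`#(Sel_𝔭^{Σ₀∪T}/Sel_𝔭^{Σ₀})[p] = ∏_{v∈T} (#H¹(H ∩ D_v, E[p^∞])[p])^{p^{c_v}}`** for a finite set `T` of places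
`v ∤ p`, `v ∉ Σ₀` with exact indices `κ(D_v) = p^{c_v} ℤ_p`, GIVEN (i) the tuple surjectivity at every `v ∈ T` out of every
intermediate `Sel^{Σ₀∪T′∪{v}}` (`hsurj`) and (ii) the `p`-divisibility of every intermediate `Sel^{Σ₀∪T′}` (`hdiv`): induction on
`T` with `#(L/N)[p] = #(M/N)[p] · #(L/M)[p]` and §3. Proof VERBATIM g13's `natCard_quotient_pTorsion_eq_prod_anyTorsion`.
[cite: GreenbergVatsal2000, §2 Prop. (2.4) and (2.10) (pp. 24–28)] -/
theorem natCard_quotient_pTorsion_eq_prod_of_surj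
    {𝔭 : HeightOneSpectrum (𝓞 K)} {γ : absoluteGaloisGroup K} (hγ : κ.IsTopGenerator γ) (S₀ : Set (HeightOneSpectrum (𝓞 K)))
    (c : HeightOneSpectrum (𝓞 K) → ℕ) (T : Finset (HeightOneSpectrum (𝓞 K)))
    (hTp : ∀ v ∈ T, ((p : ℕ) : 𝓞 K) ∉ v.asIdeal) (hTS : ∀ v ∈ T, v ∉ S₀)
    (hc : ∀ v ∈ T, ∀ z : ℤ_[p], ∃ d : decomp (K := K) v,
      (κ (d : absoluteGaloisGroup K)).toAdd = (p : ℤ_[p]) ^ c v * z)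
    (hsurj : ∀ v ∈ T, ∀ S : Set (HeightOneSpectrum (𝓞 K)), S₀ ⊆ S → S ⊆ S₀ ∪ ↑T → v ∉ S →
      ∀ f : Fin (p ^ c v) → subgroupH1 (kerD κ v) (W.geomPrimaryTorsion p),
        ∃ s ∈ selmerAc W p κ 𝔭 (insert v S), ∀ i : Fin (p ^ c v),
          resKerD κ (W.geomPrimaryTorsion p) v (W.conjH1 p κ.kerSubgroup (γ ^ (i : ℕ)) s) = f i)
    (hdiv : ∀ T' : Finset (HeightOneSpectrum (𝓞 K)), T' ⊆ T →
      ∀ s ∈ selmerAc W p κ 𝔭 (S₀ ∪ ↑T'), ∃ s' ∈ selmerAc W p κ 𝔭 (S₀ ∪ ↑T'), p • s' = s) :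
    Nat.card {b : selmerAc W p κ 𝔭 (S₀ ∪ ↑T) ⧸
        (selmerAc W p κ 𝔭 S₀).addSubgroupOf (selmerAc W p κ 𝔭 (S₀ ∪ ↑T)) // p • b = 0} =
      ∏ v ∈ T, Nat.card {f : subgroupH1 (kerD κ v) (W.geomPrimaryTorsion p) // p • f = 0} ^ (p ^ c v) := by
  induction T using Finset.induction_on with
  | empty =>
    rw [Finset.prod_empty, Finset.coe_empty, Set.union_empty]
    haveI : Subsingleton (selmerAc W p κ 𝔭 S₀ ⧸
        (selmerAc W p κ 𝔭 S₀).addSubgroupOf (selmerAc W p κ 𝔭 S₀)) :=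
      ⟨fun a b ↦ by
        induction a using QuotientAddGroup.induction_on with | H a =>
        induction b using QuotientAddGroup.induction_on with | H b =>
        exact QuotientAddGroup.eq.mpr (AddSubgroup.mem_addSubgroupOf.mpr (-a + b).2)⟩
    haveI : Nonempty {b : selmerAc W p κ 𝔭 S₀ ⧸
        (selmerAc W p κ 𝔭 S₀).addSubgroupOf (selmerAc W p κ 𝔭 S₀) // p • b = 0} := ⟨⟨0, smul_zero p⟩⟩
    exact Nat.card_unique
  | @insert v T hvT ih =>
    have hTsub : T ⊆ insert v T := Finset.subset_insert v T
    have ih' := ih (fun w hw ↦ hTp w (hTsub hw)) (fun w hw ↦ hTS w (hTsub hw))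
      (fun w hw ↦ hc w (hTsub hw))
      (fun w hw S h₀ hS hwS ↦ hsurj w (hTsub hw) S h₀
        (hS.trans (Set.union_subset_union_right S₀ (Finset.coe_subset.mpr hTsub))) hwS)
      (fun T' hT' ↦ hdiv T' (hT'.trans hTsub))
    have hvS : v ∉ S₀ ∪ ↑T := by
      rintro (h | h)
      · exact hTS v (Finset.mem_insert_self v T) h
      · exact hvT (Finset.mem_coe.mp h)
    rw [Finset.prod_insert hvT, Finset.coe_insert, Set.union_insert]
    have hNM : selmerAc W p κ 𝔭 S₀ ≤ selmerAc W p κ 𝔭 (S₀ ∪ ↑T) := selmerOver_mono Set.subset_union_left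
    have hML : selmerAc W p κ 𝔭 (S₀ ∪ ↑T) ≤ selmerAc W p κ 𝔭 (insert v (S₀ ∪ ↑T)) :=
      selmerOver_mono (Set.subset_insert _ _)
    have h3 := natCard_quotTorsion_eq_mul_of_divisible (selmerAc W p κ 𝔭 S₀)
      (selmerAc W p κ 𝔭 (S₀ ∪ ↑T)) (selmerAc W p κ 𝔭 (insert v (S₀ ∪ ↑T))) hNM hML p (hdiv T hTsub)
    have hcount := (natCard_quotient_pTorsion_eq_pow_of_surj W p κ hγ (S := S₀ ∪ ↑T)
      (hTp v (Finset.mem_insert_self v T)) hvS (hc v (Finset.mem_insert_self v T))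
      (hsurj v (Finset.mem_insert_self v T) (S₀ ∪ ↑T) Set.subset_union_left
        (Set.union_subset_union_right S₀ (Finset.coe_subset.mpr hTsub)) hvS)).2
    rw [h3, ih', hcount, mul_comm]

end Summit.BirchSwinnertonDyer.BirchSwinnertonDyer.Theorems.UniversalToricDescentSigmaLocalImage

end
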